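import Mathlib
import Summits.CriticalPhenomena.CardyFormulaZ2.Theorems.CardySelfRefinementGradientComparabilityStubDcZeroHalfGeSumPivotal
import Literature.Probability.Percolation.QuadCrossingPivotalArms
import Literature.Probability.Percolation.QuadCrossingRawClosed
import Literature.Probability.Percolation.QuadCrossingContinuityReduction
import Literature.Probability.Percolation.OpenPathAnnulusCrossing
import Literature.Probability.Percolation.AnnulusCrossingBoundProofs
import HarnessLib

/-!
# A fixed edge is pivotal for the localised joint crossing event with probability `o(1)`,
# uniformly in the edge

Crux `stmt-CriticalPhenomena-10269`
(`Summit.CriticalPhenomena.CardyFormulaZ2.Theses.CardySelfRefinement.GradientComparability`),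
line **Sketch**, stub `stub_pivotal_uniformly_small` (hypothesis (D2) of the Talagrand composition
`allEdgesPivotalSum_diverges`).  Vocabulary (`A`, `window`, `Aloc`, …) from
`CardySelfRefinementDefs`.

## Mathematics

Fix a nonempty finite quad family `F` and `ε > 0`.  If the edge `e` is pivotal for the localised
joint crossing event `Aloc m F η` in `ω`, then (the event being increasing, `isUpperSet_Aloc`)
with `ω⁺ := (ω ∪ {e}) ∩ window`, `ω⁻ := (ω ∖ {e}) ∩ window` every quad `F i` is crossed by `ω⁺`
and some quad `Q = F i` is not crossed by `ω⁻` (crossing in the Schramm–Smirnov `configOf`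
sense at mesh `η`, positions `squareLatticeEmbedding.z = √2 · Site.toComplex`, i.e. the drawing
`meshPoint δ` with `δ = η√2`).  Both configurations consist of lattice edges, so by the closedness
of the raw crossed set (`mem_z2QuadConfig_iff_exists_isCrossing`) there is a crossing `K` of `Q`
inside the drawn open edges of `ω⁺`, and none inside those of `ω⁻`.  The two drawings differ only
by the segment of `e = {u, v}`, which lies in the closed `δ`-ball around `w₀ := meshPoint δ u`;
hence `K` meets `B(w₀, 2δ)` and `K ∖ B(w₀, 2δ)` lies inside the open edges of `ω⁻`.  One endpoint
of `K` (on `∂₀Q` or on `∂₂Q`) is at distance `> R' := d/3` from `w₀`, where `d > 0` separates the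
disjoint compact opposite sides `∂₀Q`, `∂₂Q`.  Two boundary bumpings
(`exists_mem_connectedComponentIn_level`) then produce a continuum inside the open edges of `ω⁻`
joining the circle of radius `2δ` to the circle of radius `R'` inside the closed `R'`-ball, whence
(`mem_annulusOpenCrossing_of_isPreconnected`, monotonicity) `ω` lies in the open annulus-crossing
event `annulusOpenCrossing w₀ δ (c₁δ) (R' − δ)` (`c₁ = max 3 c₀`), whose `P_{1/2}`-probability is
`≤ (c₁δ/(R' − δ))^α → 0` by the RSW annulus bound `annulusOpenCrossing_half_le_holds`, uniformly in
the centre, hence in `e`.  Summing over the `m` quads and choosing `η` small gives the claim; edges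
outside the window are never pivotal.
-/

noncomputable section

namespace Summit.CriticalPhenomena.CardyFormulaZ2.Theorems.CardySelfRefinement

open scoped Topology
open Filter Set MeasureTheory
open Literature.Probability.LatticeModels Literature.Probability.Percolation
open Literature.Probability.Percolation.QuadCrossing
open Summit.CriticalPhenomena.CardyFormulaZ2.Theses.CardySelfRefinement

/-! ## Crossing in the `configOf` sense versus raw crossings inside the drawn open edges -/

/-- For a configuration of lattice edges and a positive mesh `η`, a quad is crossed in the
`configOf` (closure) sense for the isoradial drawing `squareLatticeEmbedding.z` iff it has a
crossing inside the drawn open edges `openEdgeUnion (η√2) ω` (the raw crossed set is closed). -/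
theorem mem_configOf_iff_exists_isCrossing_openEdgeUnion {η : ℝ} (hη : 0 < η)
    {ω : BondConfig (Site 2)} (hω : ω ⊆ (zdGraph 2).edgeSet) (Q : Quad (Set.univ : Set ℂ)) :
    Q ∈ configOf squareLatticeEmbedding.z η Set.univ ω ↔
      ∃ K, Q.IsCrossing K ∧ K ⊆ openEdgeUnion (η * Real.sqrt 2) ω := by
  rw [configOf_squareLatticeEmbedding,
    ← mem_z2QuadConfig_iff_exists_isCrossing (D := (Set.univ : Set ℂ)) (by positivity)]
  unfold z2QuadConfig
  rw [Set.inter_eq_left.2 hω]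

/-! ## One open arm around a destroyed crossing (deterministic geometry) -/

/-- **One open arm around a destroyed crossing.**  Let `δ > 0`, `3 ≤ c₁`, `2δ ≤ R'`, and let the
opposite sides `∂₀Q`, `∂₂Q` of the quad `Q` be at mutual distance `> 2R'`.  If `ω₁ ⊆ ω₂ ∪ {uv}`
for a lattice edge `uv`, `Q` has a crossing inside the drawn open edges of `ω₁` and none inside
those of `ω₂`, then `ω₂` has an open lattice crossing of the annulus
`A(meshPoint δ u; c₁δ, R' − δ)`. -/
theorem annulusOpenCrossing_of_crossing_destroyed (Q : Quad (Set.univ : Set ℂ)) {R' δ c₁ : ℝ}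
    (hδ : 0 < δ) (hc₁ : 3 ≤ c₁) (hδR : 2 * δ ≤ R')
    (hsides : ∀ z₀ ∈ Q.side 0, ∀ z₂ ∈ Q.side 2, 2 * R' < dist z₀ z₂)
    {u v : Site 2} (huv : (zdGraph 2).Adj u v) {ω₁ ω₂ : BondConfig (Site 2)}
    (h₁₂ : ω₁ ⊆ insert s(u, v) ω₂)
    (h₁ : ∃ K, Q.IsCrossing K ∧ K ⊆ openEdgeUnion δ ω₁)
    (h₂ : ¬ ∃ K, Q.IsCrossing K ∧ K ⊆ openEdgeUnion δ ω₂) :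
    ω₂ ∈ annulusOpenCrossing (meshPoint δ u) δ (c₁ * δ) (R' - δ) := by
  obtain ⟨K, hK, hKω⟩ := h₁
  obtain ⟨hKc, hKconn, hKQ, ⟨x₀, hx₀K, hx₀⟩, ⟨x₂, hx₂K, hx₂⟩⟩ := hK
  set w₀ : ℂ := meshPoint δ u with hw₀
  -- the open edges of `ω₁` lie in those of `ω₂` plus the closed `δ`-ball around `w₀`
  have hcover : openEdgeUnion δ ω₁ ⊆ openEdgeUnion δ ω₂ ∪ Metric.closedBall w₀ δ := by
    intro w hw
    obtain ⟨x, y, hxy, hmem, hws⟩ := mem_openEdgeUnion_iff.1 hw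
    rcases Set.mem_insert_iff.1 (h₁₂ hmem) with he | hω₂
    · right
      rw [Metric.mem_closedBall, dist_comm]
      rcases Sym2.eq_iff.1 he with ⟨rfl, rfl⟩ | ⟨rfl, rfl⟩
      · exact dist_meshPoint_le_of_mem_segment hδ hxy hws
      · rw [segment_symm] at hws
        exact dist_meshPoint_le_of_mem_segment hδ hxy.symm hws
    · exact Or.inl (mem_openEdgeUnion_iff.2 ⟨x, y, hxy, hω₂, hws⟩)
  -- off the ball `B(w₀, 2δ)` the crossing lies inside the open edges of `ω₂`
  have hKO : K ∩ {z | 2 * δ ≤ dist z w₀} ⊆ openEdgeUnion δ ω₂ := by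
    rintro z ⟨hzK, hz⟩
    rcases hcover (hKω hzK) with h | h
    · exact h
    · exfalso
      rw [Metric.mem_closedBall] at h
      have hz' : 2 * δ ≤ dist z w₀ := hz
      linarith
  -- `K` meets the ball (else it would be a crossing inside the open edges of `ω₂`)
  have hmeet : ∃ y ∈ K, dist y w₀ < 2 * δ := by
    by_contra hcon
    push Not at hcon
    exact h₂ ⟨K, ⟨hKc, hKconn, hKQ, ⟨x₀, hx₀K, hx₀⟩, ⟨x₂, hx₂K, hx₂⟩⟩,
      fun z hz => hKO ⟨hz, hcon z hz⟩⟩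
  -- an endpoint of `K` far from `w₀`
  obtain ⟨x, hxK, hxfar⟩ : ∃ x ∈ K, R' < dist x w₀ := by
    by_contra hcon
    push Not at hcon
    have h := hsides x₀ hx₀ x₂ hx₂
    have htri := dist_triangle x₀ w₀ x₂
    rw [dist_comm w₀ x₂] at htri
    linarith [hcon x₀ hx₀K, hcon x₂ hx₂K]
  have hx2δ : 2 * δ ≤ dist x w₀ := hδR.trans hxfar.le
  -- first boundary bumping: the component of `x` off the ball reaches the circle of radius `2δ`
  have hφ : Continuous fun z : ℂ => dist z w₀ := continuous_id.dist continuous_const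
  obtain ⟨z, hzC, hz⟩ := exists_mem_connectedComponentIn_level hKc hKconn.isPreconnected hφ hxK
    hx2δ hmeet
  set C : Set ℂ := connectedComponentIn (K ∩ {z | 2 * δ ≤ dist z w₀}) x with hC
  have hCsub : C ⊆ K ∩ {z | 2 * δ ≤ dist z w₀} := connectedComponentIn_subset _ _
  have hCc : IsCompact C :=
    isCompact_connectedComponentIn (hKc.inter_right (isClosed_le continuous_const hφ)) x
  have hxC : x ∈ C := mem_connectedComponentIn ⟨hxK, hx2δ⟩
  have hCconn : IsConnected C := isConnected_connectedComponentIn_iff.2 ⟨hxK, hx2δ⟩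
  -- second boundary bumping: the component of `z` in `C ∩ B̄(w₀, R')` reaches the circle `R'`
  have hψ : Continuous fun z : ℂ => -dist z w₀ := hφ.neg
  have hzR : -R' ≤ -dist z w₀ := by rw [hz]; linarith
  obtain ⟨b, hbC', hb⟩ := exists_mem_connectedComponentIn_level hCc hCconn.isPreconnected hψ hzC
    hzR ⟨x, hxC, by show -dist x w₀ < -R'; linarith⟩
  set C' : Set ℂ := connectedComponentIn (C ∩ {z' | -R' ≤ -dist z' w₀}) z with hC'
  have hC'sub : C' ⊆ C ∩ {z' | -R' ≤ -dist z' w₀} := connectedComponentIn_subset _ _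
  have hC'c : IsCompact C' :=
    isCompact_connectedComponentIn (hCc.inter_right (isClosed_le continuous_const hψ)) z
  have hzC' : z ∈ C' := mem_connectedComponentIn ⟨hzC, hzR⟩
  have hC'conn : IsConnected C' := isConnected_connectedComponentIn_iff.2 ⟨hzC, hzR⟩
  have hC'O : C' ⊆ openEdgeUnion δ ω₂ := fun z' hz' => hKO (hCsub (hC'sub hz').1)
  have hzr : dist z w₀ ≤ c₁ * δ - δ := by rw [hz]; nlinarith
  have hbR : R' ≤ dist b w₀ := by
    have hb' : -dist b w₀ = -R' := hb
    linarith
  have hC'R : ∀ z' ∈ C', dist z' w₀ ≤ R' := fun z' hz' => by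
    have h := (hC'sub hz').2
    simp only [Set.mem_setOf_eq] at h
    linarith
  have key := mem_annulusOpenCrossing_of_isPreconnected hδ w₀ hC'c hC'conn.isPreconnected hC'O
    hzC' hbC' hzr hbR hC'R
  rwa [sub_add_cancel] at key

/-! ## The probability that changing one edge changes the crossing of one quad is `o(1)` -/

/-- **One quad, one edge.**  For a quad `Q` and `ε > 0`: for all small meshes `η > 0`, every set
`W` of lattice edges and every edge `e`, the `P_{1/2}`-probability that `Q` is crossed by
`(ω ∪ {e}) ∩ W` but not by `(ω ∖ {e}) ∩ W` is at most `ε` (one open arm around `e` to distance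
`≍ dist(∂₀Q, ∂₂Q)`, RSW annulus bound, uniformly in the centre). -/
theorem eventually_real_crossing_destroyed_le (Q : Quad (Set.univ : Set ℂ)) {ε : ℝ}
    (hε : 0 < ε) :
    ∀ᶠ η in 𝓝[>] (0 : ℝ), ∀ W : Set (Sym2 (Site 2)), W ⊆ (zdGraph 2).edgeSet →
      ∀ e : Sym2 (Site 2), (bondPercolation (zdGraph 2) half).real
        {ω | Q ∈ configOf squareLatticeEmbedding.z η Set.univ (insert e ω ∩ W) ∧
          Q ∉ configOf squareLatticeEmbedding.z η Set.univ (ω \ {e} ∩ W)} ≤ ε := by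
  obtain ⟨α, c₀, hα, hc₀, hbound⟩ := annulusOpenCrossing_half_le_holds
  obtain ⟨d, hd, hdist⟩ := Q.exists_pos_le_dist_side_side_add_two 0
  set c₁ : ℝ := max 3 c₀ with hc₁
  set R' : ℝ := d / 3 with hR'
  have hR'pos : 0 < R' := by positivity
  have hc₁3 : (3 : ℝ) ≤ c₁ := le_max_left _ _
  have hc₀c₁ : c₀ ≤ c₁ := le_max_right _ _
  have hsides : ∀ z₀ ∈ Q.side 0, ∀ z₂ ∈ Q.side 2, 2 * R' < dist z₀ z₂ := fun z₀ h₀ z₂ h₂ => by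
    have h := hdist z₀ h₀ z₂ h₂
    rw [hR']
    linarith
  -- the three smallness conditions on the mesh
  have h0 : ∀ᶠ η in 𝓝[>] (0 : ℝ), 0 < η := eventually_mem_nhdsWithin
  have h1 : ∀ᶠ η in 𝓝[>] (0 : ℝ), (2 * c₁ + 1) * (η * Real.sqrt 2) ≤ R' := by
    have ht : Tendsto (fun η : ℝ => (2 * c₁ + 1) * (η * Real.sqrt 2)) (𝓝 0) (𝓝 0) := by
      have hc : Continuous fun η : ℝ => (2 * c₁ + 1) * (η * Real.sqrt 2) :=
        continuous_const.mul (continuous_id.mul continuous_const)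
      simpa using hc.tendsto 0
    exact (ht.eventually_le_const hR'pos).filter_mono nhdsWithin_le_nhds
  have h2 : ∀ᶠ η in 𝓝[>] (0 : ℝ),
      (c₁ * (η * Real.sqrt 2) / (R' - η * Real.sqrt 2)) ^ α ≤ ε := by
    have ht : Tendsto (fun η : ℝ => c₁ * (η * Real.sqrt 2) / (R' - η * Real.sqrt 2))
        (𝓝 0) (𝓝 0) := by
      have hc : ContinuousAt
          (fun η : ℝ => c₁ * (η * Real.sqrt 2) / (R' - η * Real.sqrt 2)) 0 :=
        (continuous_const.mul (continuous_id.mul continuous_const)).continuousAt.div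
          (continuous_const.sub (continuous_id.mul continuous_const)).continuousAt
          (by simpa using hR'pos.ne')
      simpa using hc.tendsto
    exact ((ht.rpow_const_nhds_zero hα).eventually_le_const hε).filter_mono nhdsWithin_le_nhds
  filter_upwards [h0, h1, h2] with η hη0 hη1 hη2 W hW
  set δ : ℝ := η * Real.sqrt 2 with hδdef
  have hδ : 0 < δ := by positivity
  refine Sym2.ind (fun u v => ?_)
  by_cases he : s(u, v) ∈ W
  · have huv : (zdGraph 2).Adj u v := (SimpleGraph.mem_edgeSet _).1 (hW he)
    calc (bondPercolation (zdGraph 2) half).real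
          {ω | Q ∈ configOf squareLatticeEmbedding.z η Set.univ (insert s(u, v) ω ∩ W) ∧
            Q ∉ configOf squareLatticeEmbedding.z η Set.univ (ω \ {s(u, v)} ∩ W)}
        ≤ (bondPercolation (zdGraph 2) half).real
            (annulusOpenCrossing (meshPoint δ u) δ (c₁ * δ) (R' - δ)) := by
          refine measureReal_mono (fun ω hω => ?_)
          obtain ⟨hin, hout⟩ := hω
          have hW₁ : insert s(u, v) ω ∩ W ⊆ (zdGraph 2).edgeSet := Set.inter_subset_right.trans hW
          have hW₂ : ω \ {s(u, v)} ∩ W ⊆ (zdGraph 2).edgeSet := Set.inter_subset_right.trans hW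
          rw [mem_configOf_iff_exists_isCrossing_openEdgeUnion hη0 hW₁] at hin
          rw [mem_configOf_iff_exists_isCrossing_openEdgeUnion hη0 hW₂] at hout
          have h₁₂ : insert s(u, v) ω ∩ W ⊆ insert s(u, v) (ω \ {s(u, v)} ∩ W) := by
            rintro f ⟨hf, hfW⟩
            by_cases hfe : f = s(u, v)
            · exact hfe ▸ Set.mem_insert _ _
            · rcases Set.mem_insert_iff.1 hf with hfe' | hfω
              · exact absurd hfe' hfe
              · exact Set.mem_insert_of_mem _ ⟨⟨hfω, hfe⟩, hfW⟩
          exact isUpperSet_annulusOpenCrossing _ _ _ _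
            (Set.inter_subset_left.trans Set.sdiff_subset)
            (annulusOpenCrossing_of_crossing_destroyed Q hδ hc₁3 (by nlinarith) hsides huv h₁₂
              hin hout)
      _ ≤ (c₁ * δ / (R' - δ)) ^ α :=
          hbound _ δ (c₁ * δ) (R' - δ) hδ (by nlinarith) (by nlinarith)
      _ ≤ ε := hη2
  · -- an edge outside `W` changes nothing
    have hempty : {ω : BondConfig (Site 2) |
        Q ∈ configOf squareLatticeEmbedding.z η Set.univ (insert s(u, v) ω ∩ W) ∧
          Q ∉ configOf squareLatticeEmbedding.z η Set.univ (ω \ {s(u, v)} ∩ W)} = ∅ := by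
      ext ω
      simp only [Set.mem_setOf_eq, Set.mem_empty_iff_false, iff_false, not_and, not_not]
      rw [Set.insert_inter_of_notMem he, Set.sdiff_inter_right_comm,
        Set.sdiff_singleton_eq_self (fun h => he h.2)]
      exact id
    rw [hempty, measureReal_empty]
    exact hε.le

/-! ## The stub -/

/-- **(D2) `P(e pivotal) ≤ ε` for small mesh, UNIFORMLY in the edge `e` (provable now:
QuadCrossingPivotalArms + RSW annulus bound).**  If `e` is pivotal for `Aloc` then, `Aloc` being
increasing, `(ω ∪ {e}) ∩ window` crosses every quad while `(ω ∖ {e}) ∩ window` fails to cross some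
`F i`; the crossing destroyed by closing `e` leaves an open arm from the `2δ`-ball around the drawn
edge to distance `dist(∂₀F i, ∂₂F i)/3` (`annulusOpenCrossing_of_crossing_destroyed`), whose
probability is `≤ (c₁δ/(R' − δ))^α → 0` by the RSW annulus bound, uniformly over the centre; sum
over the `m` quads. -/
theorem stub_pivotal_uniformly_small :
    ∀ (m : ℕ) (F : Fin m → Quad (Set.univ : Set ℂ)), 0 < m → ∀ ε : ℝ, 0 < ε →
      ∃ η₃ : ℝ, 0 < η₃ ∧ ∀ η ∈ Set.Ioo 0 η₃, ∀ e : Sym2 (Site 2),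
        (bondPercolation (zdGraph 2) half).real {ω | IsPivotal (Aloc m F η) e ω} ≤ ε := by
  intro m F hm ε hε
  have hmpos : (0 : ℝ) < m := by exact_mod_cast hm
  have hev : ∀ᶠ η in 𝓝[>] (0 : ℝ), ∀ e : Sym2 (Site 2),
      (bondPercolation (zdGraph 2) half).real {ω | IsPivotal (Aloc m F η) e ω} ≤ ε := by
    have hall := Filter.eventually_all.2 fun i : Fin m =>
      eventually_real_crossing_destroyed_le (F i) (div_pos hε hmpos)
    filter_upwards [hall] with η hη e
    have hW : window m F η ⊆ (zdGraph 2).edgeSet :=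
      Set.iUnion_subset fun i => Set.inter_subset_right
    calc (bondPercolation (zdGraph 2) half).real {ω | IsPivotal (Aloc m F η) e ω}
        ≤ (bondPercolation (zdGraph 2) half).real (⋃ i : Fin m,
            {ω | F i ∈ configOf squareLatticeEmbedding.z η Set.univ (insert e ω ∩ window m F η) ∧
              F i ∉ configOf squareLatticeEmbedding.z η Set.univ
                (ω \ {e} ∩ window m F η)}) := by
          refine measureReal_mono (fun ω hω => ?_)
          have h1 : insert e ω ∈ Aloc m F η ∧ ω \ {e} ∉ Aloc m F η := by
            rcases hω with ⟨ha, hb⟩ | ⟨ha, hb⟩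
            · exact ⟨ha, hb⟩
            · exact absurd (isUpperSet_Aloc m F η
                (Set.sdiff_subset.trans (Set.subset_insert e ω)) ha) hb
          obtain ⟨hin, hout⟩ := h1
          have hin' : ∀ i, F i ∈ configOf squareLatticeEmbedding.z η Set.univ
              (insert e ω ∩ window m F η) := hin
          have hout' : ¬ ∀ i, F i ∈ configOf squareLatticeEmbedding.z η Set.univ
              (ω \ {e} ∩ window m F η) := hout
          obtain ⟨i, hi⟩ := not_forall.1 hout'
          exact Set.mem_iUnion.2 ⟨i, hin' i, hi⟩
      _ ≤ ∑ i : Fin m, (bondPercolation (zdGraph 2) half).real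
            {ω | F i ∈ configOf squareLatticeEmbedding.z η Set.univ (insert e ω ∩ window m F η) ∧
              F i ∉ configOf squareLatticeEmbedding.z η Set.univ
                (ω \ {e} ∩ window m F η)} :=
          measureReal_iUnion_fintype_le _
      _ ≤ ∑ _i : Fin m, ε / m := Finset.sum_le_sum fun i _ => hη i _ hW e
      _ = ε := by
          rw [Finset.sum_const, Finset.card_univ, Fintype.card_fin, nsmul_eq_mul]
          field_simp
  obtain ⟨η₃, hη₃, h⟩ := (nhdsGT_basis (0 : ℝ)).eventually_iff.1 hev
  exact ⟨η₃, hη₃, fun η hη => h hη⟩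

end Summit.CriticalPhenomena.CardyFormulaZ2.Theorems.CardySelfRefinement

end
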